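import Summits.QuantumFields.YangMills.Theorems.UnitScaleTiltProp7LocMinOfGaugedRows
import Summits.QuantumFields.YangMills.Theorems.UnitScaleTiltProp7FirstVariationMultiplierBoundWeakEL
import Summits.QuantumFields.YangMills.Theorems.UnitScaleTiltMinimiserStabilityRegPrPV3EChart
import Summits.QuantumFields.YangMills.Theorems.UnitScaleTiltProp7SPrintIn19Dict
import HarnessLib

/-!
# Route `UnitScaleTilt`, crux K1 child «MinimiserStabilityRegPr» (stmt-QuantumFields-19200) — `hcoW` OF THE EX KNIT OF RECORD FROM THE GAUGED ROWS
# (the EX twin of ★p1-19200 g14's ✓`Prop7LocMinOfGaugedRows`: the JOINT remainder row read MODULO COARSE PURE GAUGES at an E–L-critical background)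

Cell `ym3-torus`, width seat `ym-ust-19200-w4` (gen 5; offer (o3) on the bus 2026-08-28).  THEOREMS ONLY (0 `def`, 0 `sorry`).  YM₃ on T³ is a ladder rung (R3),
not the Clay problem; nothing here claims the stub `stub_existenceMinimalOrbit`, the row E′, the crux, d = 4 or the mass gap; `--supports stmt-QuantumFields-19200`,
count-neutral.

WHY.  ★p1 g14's namer word (n3) «conserved-current shortcut» (2026-08-28 15:11Z) reads the JOINT remainder row of the growth-side doors MODULO COARSE PURE GAUGES:
`Lin_W` kills every infinitesimal gauge direction (✓`Prop7LinGaugeInvariance.lin_sub_gaugeDir_eq`) and every recursion family `Q` of the true one-step linearisations is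
exact on pure gauges (✓`Prop7TrueLinPureGaugeIter.trueLinIter_pureGauge`), so the first variation along an `𝔰𝔲(2)`-valued `A` is charged by
`2e·ℓ⁻¹·Σ_c‖(Q (K−n) A)(c) − (μ(c₋) − W̄^{(K−n)}(c)·μ(c₊)·W̄^{(K−n)}(c)*)‖` for EVERY `𝔰𝔲(2)`-valued coarse site field `μ` — and with `μ := −Λ_{K−n}` (the coarse gauge
function of record) that sum is the `ℓ¹` norm of the REDUCED sourced family, MASS channel only (✓`Prop7TrueLinSourcedStructure.sourced_structure`,
✓`Prop7TrueLinSourcedDefectL1.sum_norm_sourcedReduced_le`).  ✓`Prop7LocMinOfGaugedRows` (p644509) is the E′ door in that currency, at an R2-critical background (the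
exact pairing ✓`abs_lin_le_sum_norm_trueLinIter` needs `IsCritR2`).  The EX knit of record (✓`Prop7StubEXOfChartPiecesTwS5.stubEX_of_chartPiecesTwS5`, socket `hcoW`)
sits at an E–L-CRITICAL chart background instead (its clause «`deriv (A ∘ γ) 0 = 0` along every differentiable fibre curve through `W`»), where the pairing of record is
★routeR-w2's ✓`Prop7FirstVariationMultiplierBoundWeakEL.abs_lin_le_sum_norm_trueLinIter_weakEL` (fed by ✓`Prop7FirstVariationWeakEL.weakEL_of_fibreEL`).  This file is
the EX-side twin: the gauged pairing under the WEAK E–L letter (§1) and `hcoW` from the per-competitor rows {CHART `s`, HESS_W′ `κ`, JOINT MOD COARSE GAUGE `(C₁, C₂)`}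
(§2) — so the JOINT supplier's output (★p1 g14's F2∕F4: `‖G_{K−n}‖₁ ≤ C₁ℓ⁻¹·M + C₂ℓ·K`, `μ := −Λ_{K−n}` `𝔰𝔲(2)`-valued by F0) is consumed by the EX knit in the SAME
currency as by E′.

WHAT IS PROVED (ns `…Theorems.Prop7HcoWOfGaugedRows`).
* §1 ★★ `abs_lin_le_sum_norm_trueLinIter_weakEL_sub_coarseGauge` — ✓`Prop7LocMinOfGaugedRows.abs_lin_le_sum_norm_trueLinIter_sub_coarseGauge` with `hcrit : IsCritR2`
  replaced by the weak E–L letters `(hU₀fib) (hELw)` of ✓`abs_lin_le_sum_norm_trueLinIter_weakEL` (VERBATIM); same proof (`λ := μ ∘ iterBlockOf (K−n)`,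
  ✓`lin_sub_gaugeDir_eq`, the weak-EL pairing at the `𝔰𝔲(2)`-valued `A − Z^λ`, ✓`trueLinIter_sub` ∕ ✓`trueLinIter_pureGauge` under ✓`tower_loop_rows_of_regPr`,
  ✓`Node00.iterBlockOf_embIter_eq`).
* §2 ★★★ `hcoW_of_gaugedRowsW` — HYPOTHESIS `hQW` = this base's ✓`Prop7HcoWOfQRows.hcoW_of_QRowsW` (p639554) VERBATIM except that the JOINT row is displayed MODULO COARSE
  GAUGE exactly as in ✓`Prop7LocMinOfGaugedRows.isMinOn_regFibrePr_of_gaugedRows_at` (`∃ μ : Site (F.P K) (K−n) → M₂(ℂ)`, `𝔰𝔲(2)`-valued, after `Q`); CONCLUSION = `hcoW` of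
  the EX knit VERBATIM (as in p639554).  PROOF = p639554's with §1 in place of the un-gauged pairing and ✓`Prop7LocMinOfJointRow.linRow_of_QRows` at `R :=` the gauged sum,
  then the Taylor door ✓`wilsonAction4_le_expChart_of_linRow`.

HONEST SCOPE.  Bookkeeping over landed letters; the rows CHART ([Balaban1985RegularSpaces] Thm 2 at the chart background), HESS_W′ ((H1) on the Landau slice) and the
JOINT remainder modulo coarse gauge (★p1 g14's F2∕F4 lane) remain the displayed suppliers; nothing of print is asserted.  E′ and EX are NOT closed by this file.

References: T. Bałaban, CMP 102 (1985) 277–309 [Balaban1985Variational] ((2), (4)–(7) p.278, (47)–(49) pp.285–286, (112) p.294, (116) p.295, (136)–(143) pp.298–299,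
Prop. 7 p.299); CMP 99 (1985) 389–434 [Balaban1985BackgroundPropagators] ((3.9)–(3.11) p.392); CMP 98 (1985) 17–51 [Balaban1985Averaging] ((11) p.19, (124) p.36).
-/

set_option autoImplicit false
noncomputable section

open scoped BigOperators Matrix.Norms.L2Operator Matrix Topology
open Filter NormedSpace

namespace Summit.QuantumFields.YangMills.Theorems.Prop7HcoWOfGaugedRows

open Literature.MathematicalPhysics.QuantumFieldTheory.Balaban1983to89
open Literature.MathematicalPhysics.QuantumFieldTheory.Balaban1983to89.T3ContinuumYM3Torus
open Literature.MathematicalPhysics.QuantumFieldTheory.Balaban1983to89.T3UnitLawDensityEML (ℰp)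
open Literature.MathematicalPhysics.QuantumFieldTheory.Balaban1983to89.T3ConstrainedMinimiser (fibre)
open Literature.MathematicalPhysics.QuantumFieldTheory.Balaban1983to89.T3PrintedRegularMinimiser
open Literature.MathematicalPhysics.QuantumFieldTheory.Balaban1983to89.T3RegularMinimiser
open Literature.MathematicalPhysics.QuantumFieldTheory.Balaban1983to89.T3Thm1Carrier
open T4Continuum BlockAveraging AveragingRT ExpMeanLog BlockAveragingEMLLinearised BlockAveragingEMLLinearisedBackground BlockAveragingEMLProp2
open B10Eq27TorusAxialLog (pull)
open T3SectALandauChart (emb15 eta bgUnits pos_of_regPr)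
open Summit.QuantumFields.YangMills.Theorems.Prop7SPrint (basePt RestrictedPrint)
open Summit.QuantumFields.YangMills.Theorems.Prop7TPrint (expHerm expHermField expHermField_apply coe_expHerm)
open Summit.QuantumFields.YangMills.Theorems.Prop7SPrintIn19 (trace_eq_zero_of_exp_mem_SU2)
open Summit.QuantumFields.YangMills.Theorems.Prop7LocMinOfJointRow (wilsonAction4_le_expChart_of_linRow linRow_of_QRows)
open Summit.QuantumFields.YangMills.Theorems.Prop7CurvedLandauRowA (exists_trueLinIter_family)
open Summit.QuantumFields.YangMills.Theorems.Prop7FirstVariationWeakEL (weakEL_of_fibreEL)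
open Summit.QuantumFields.YangMills.Theorems.Prop7FirstVariationMultiplierBoundWeakEL (abs_lin_le_sum_norm_trueLinIter_weakEL)
open Summit.QuantumFields.YangMills.Theorems.Prop7FirstVariationExactPairing (tower_loop_rows_of_regPr gaugeDir_mem_su2)
open Summit.QuantumFields.YangMills.Theorems.Prop7TrueLinPureGaugeIter (trueLinIter_sub trueLinIter_pureGauge)
open Summit.QuantumFields.YangMills.Theorems.Prop7LinGaugeInvariance (lin_sub_gaugeDir_eq)
open Summit.QuantumFields.YangMills.Theorems.Prop7LocMinOfGaugedRows (sub_gaugeDir_mem_su2)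
open B15DeterminingSets (embIter)
open B5Eq118OneStroke (iterBlockOf)
open Node00 (iterBlockOf_embIter_eq)

/-! ## §1 The gauged pairing under the WEAK E–L letter -/

set_option maxHeartbeats 400000 in
/-- ★★ **THE GAUGED PAIRING AT A WEAKLY E–L-CRITICAL BACKGROUND — THE MULTIPLIER CURRENT IS COVARIANTLY CONSERVED.**  For `U₀ ∈ 𝔅_k(V) ∩ (6)(ε₀)`
(`10¹⁰L⁶ε₀ ≤ 1`) satisfying the WEAK E–L letter `hELw` («the first variation vanishes along the velocity of every differentiable curve through `U₀` that stays in the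
fibre near `t = 0`»), every recursion family `Q` of the true one-step linearisations along `U₀`'s tower, every `𝔰𝔲(2)`-valued bond field `A` and every `𝔰𝔲(2)`-valued
COARSE site field `μ` on the level-`(K−n)` lattice: `|Lin_{U₀}(A)| ≤ 2ε₀·L^{−(K−n)}·Σ_c‖(Q (K−n) A)(c) − (μ(c₋) − Ū₀^{(K−n)}(c)·μ(c₊)·Ū₀^{(K−n)}(c)*)‖`.  The E–L twin of
✓`Prop7LocMinOfGaugedRows.abs_lin_le_sum_norm_trueLinIter_sub_coarseGauge` (there `U₀` is R2-critical): `λ := μ ∘ iterBlockOf (K−n)`; `Lin_{U₀}(A) = Lin_{U₀}(A − Z^λ)`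
(✓`lin_sub_gaugeDir_eq`); the weak-EL pairing ✓`abs_lin_le_sum_norm_trueLinIter_weakEL` at the `𝔰𝔲(2)`-valued `A − Z^λ`; `Q (K−n) (A − Z^λ) = Q (K−n) A − P_{Ū₀^{(K−n)}}(λ ∘ embIter (K−n))`
(✓`trueLinIter_sub`, ✓`trueLinIter_pureGauge` under the (0.4) guards of ✓`tower_loop_rows_of_regPr`).
[cite: Balaban1985Variational, (141)-(143) p.299, (112) p.294; Balaban1985BackgroundPropagators, (3.9)-(3.11) p.392; Balaban1985Averaging, (11) p.19, (124) p.36] -/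
theorem abs_lin_le_sum_norm_trueLinIter_weakEL_sub_coarseGauge (F : T3Family) {n K : ℕ} (hnK : n ≤ K)
    {V : GaugeField (F.P n) 0 (Matrix.specialUnitaryGroup (Fin 2) ℂ)} {U₀ : GaugeField (F.P K) 0 (Matrix.specialUnitaryGroup (Fin 2) ℂ)}
    (hU₀fib : U₀ ∈ fibre F ℰp n K hnK V)
    (hELw : ∀ (γ : ℝ → GaugeField (F.P K) 0 (Matrix.specialUnitaryGroup (Fin 2) ℂ)) (ξ : PBond (F.P K) 0 → Matrix (Fin 2) (Fin 2) ℂ), γ 0 = U₀ →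
      (∀ b : PBond (F.P K) 0, DifferentiableAt ℝ (fun t : ℝ => (γ t b : Matrix (Fin 2) (Fin 2) ℂ)) 0) →
      (∀ᶠ t in 𝓝 (0 : ℝ), γ t ∈ fibre F ℰp n K hnK V) →
      (∀ b : PBond (F.P K) 0, HasDerivAt (fun t : ℝ => (γ t b : Matrix (Fin 2) (Fin 2) ℂ) * star (U₀ b : Matrix (Fin 2) (Fin 2) ℂ)) (ξ b) 0) →
        ∑ p : Plaq (F.P K) 0, (1 / 2) * ((((((GaugeField.plaqHol U₀ p : Matrix.specialUnitaryGroup (Fin 2) ℂ) : Matrix (Fin 2) (Fin 2) ℂ)) - 1)ᴴ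
          * ((ξ ⟨p.src, p.μ⟩
              + (U₀ ⟨p.src, p.μ⟩ : Matrix (Fin 2) (Fin 2) ℂ) * ξ ⟨p.src.shift p.μ, p.ν⟩ * star (U₀ ⟨p.src, p.μ⟩ : Matrix (Fin 2) (Fin 2) ℂ)
              - ((U₀ ⟨p.src, p.μ⟩ * U₀ ⟨p.src.shift p.μ, p.ν⟩ * (U₀ ⟨p.src.shift p.ν, p.μ⟩)⁻¹ : Matrix.specialUnitaryGroup (Fin 2) ℂ) : Matrix (Fin 2) (Fin 2) ℂ)
                  * ξ ⟨p.src.shift p.ν, p.μ⟩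
                  * star ((U₀ ⟨p.src, p.μ⟩ * U₀ ⟨p.src.shift p.μ, p.ν⟩ * (U₀ ⟨p.src.shift p.ν, p.μ⟩)⁻¹ : Matrix.specialUnitaryGroup (Fin 2) ℂ) : Matrix (Fin 2) (Fin 2) ℂ)
              - ((GaugeField.plaqHol U₀ p : Matrix.specialUnitaryGroup (Fin 2) ℂ) : Matrix (Fin 2) (Fin 2) ℂ) * ξ ⟨p.src, p.ν⟩
                  * star ((GaugeField.plaqHol U₀ p : Matrix.specialUnitaryGroup (Fin 2) ℂ) : Matrix (Fin 2) (Fin 2) ℂ))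
            * ((GaugeField.plaqHol U₀ p : Matrix.specialUnitaryGroup (Fin 2) ℂ) : Matrix (Fin 2) (Fin 2) ℂ))).trace).re = 0)
    {ε₀ : ℝ} (hε₀ : 0 < ε₀) (hε : 10 ^ 10 * (F.L : ℝ) ^ 6 * ε₀ ≤ 1) (hU₀reg : RegPr F n K ε₀ U₀)
    (Q : (k : ℕ) → (PBond (F.P K) 0 → Matrix (Fin 2) (Fin 2) ℂ) → PBond (F.P K) k → Matrix (Fin 2) (Fin 2) ℂ) (hQ0 : ∀ Y, Q 0 Y = Y)
    (hQs : ∀ (k : ℕ) (Y : PBond (F.P K) 0 → Matrix (Fin 2) (Fin 2) ℂ) (c : PBond (F.P K) (k + 1)), Q (k + 1) Y c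
      = fderiv ℂ (eml : (Idx (F.P K) → Matrix (Fin 2) (Fin 2) ℂ) → Matrix (Fin 2) (Fin 2) ℂ)
            (fun i => ((loopHol (Averaging.iter (fun i => blockAvg (P := F.P K) (j := i) (expMeanLogSU (n := Fin 2))) k U₀) c i :
              Matrix.specialUnitaryGroup (Fin 2) ℂ) : Matrix (Fin 2) (Fin 2) ℂ))
            (fun i => covWalkSum (Averaging.iter (fun i => blockAvg (P := F.P K) (j := i) (expMeanLogSU (n := Fin 2))) k U₀) (Q k Y)
                (walk (emb c.src) (loopWord (F.P K).L c.dir (off i.1) i.2.1 i.2.2))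
              * ((loopHol (Averaging.iter (fun i => blockAvg (P := F.P K) (j := i) (expMeanLogSU (n := Fin 2))) k U₀) c i :
                Matrix.specialUnitaryGroup (Fin 2) ℂ) : Matrix (Fin 2) (Fin 2) ℂ))
            * star ((corr (expMeanLogSU (n := Fin 2)) (Averaging.iter (fun i => blockAvg (P := F.P K) (j := i) (expMeanLogSU (n := Fin 2))) k U₀) c :
                Matrix.specialUnitaryGroup (Fin 2) ℂ) : Matrix (Fin 2) (Fin 2) ℂ)
          + ((corr (expMeanLogSU (n := Fin 2)) (Averaging.iter (fun i => blockAvg (P := F.P K) (j := i) (expMeanLogSU (n := Fin 2))) k U₀) c :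
                Matrix.specialUnitaryGroup (Fin 2) ℂ) : Matrix (Fin 2) (Fin 2) ℂ)
            * covWalkSum (Averaging.iter (fun i => blockAvg (P := F.P K) (j := i) (expMeanLogSU (n := Fin 2))) k U₀) (Q k Y)
                (walk (emb c.src) (List.replicate (F.P K).L (c.dir, true)))
            * star ((corr (expMeanLogSU (n := Fin 2)) (Averaging.iter (fun i => blockAvg (P := F.P K) (j := i) (expMeanLogSU (n := Fin 2))) k U₀) c :
                Matrix.specialUnitaryGroup (Fin 2) ℂ) : Matrix (Fin 2) (Fin 2) ℂ))
    (A : PBond (F.P K) 0 → Matrix (Fin 2) (Fin 2) ℂ) (hA : ∀ b, A b ∈ skewAdjoint (Matrix (Fin 2) (Fin 2) ℂ)) (htr : ∀ b, (A b).trace = 0)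
    (μ : Site (F.P K) (K - n) → Matrix (Fin 2) (Fin 2) ℂ) (hμ : ∀ y, μ y ∈ skewAdjoint (Matrix (Fin 2) (Fin 2) ℂ)) (hμt : ∀ y, (μ y).trace = 0) :
    |∑ p : Plaq (F.P K) 0, (1 / 2) * ((((((GaugeField.plaqHol U₀ p : Matrix.specialUnitaryGroup (Fin 2) ℂ) : Matrix (Fin 2) (Fin 2) ℂ)) - 1)ᴴ
          * ((A ⟨p.src, p.μ⟩
              + (U₀ ⟨p.src, p.μ⟩ : Matrix (Fin 2) (Fin 2) ℂ) * A ⟨p.src.shift p.μ, p.ν⟩ * star (U₀ ⟨p.src, p.μ⟩ : Matrix (Fin 2) (Fin 2) ℂ)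
              - ((U₀ ⟨p.src, p.μ⟩ * U₀ ⟨p.src.shift p.μ, p.ν⟩ * (U₀ ⟨p.src.shift p.ν, p.μ⟩)⁻¹ : Matrix.specialUnitaryGroup (Fin 2) ℂ) : Matrix (Fin 2) (Fin 2) ℂ)
                  * A ⟨p.src.shift p.ν, p.μ⟩
                  * star ((U₀ ⟨p.src, p.μ⟩ * U₀ ⟨p.src.shift p.μ, p.ν⟩ * (U₀ ⟨p.src.shift p.ν, p.μ⟩)⁻¹ : Matrix.specialUnitaryGroup (Fin 2) ℂ) : Matrix (Fin 2) (Fin 2) ℂ)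
              - ((GaugeField.plaqHol U₀ p : Matrix.specialUnitaryGroup (Fin 2) ℂ) : Matrix (Fin 2) (Fin 2) ℂ) * A ⟨p.src, p.ν⟩
                  * star ((GaugeField.plaqHol U₀ p : Matrix.specialUnitaryGroup (Fin 2) ℂ) : Matrix (Fin 2) (Fin 2) ℂ))
            * ((GaugeField.plaqHol U₀ p : Matrix.specialUnitaryGroup (Fin 2) ℂ) : Matrix (Fin 2) (Fin 2) ℂ))).trace).re|
      ≤ 2 * ε₀ * ((F.L : ℝ) ^ (K - n))⁻¹ * ∑ c : PBond (F.P K) (K - n), ‖Q (K - n) A c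
          - (μ c.src
              - ((Averaging.iter (fun i => blockAvg (P := F.P K) (j := i) (expMeanLogSU (n := Fin 2))) (K - n) U₀ c : Matrix.specialUnitaryGroup (Fin 2) ℂ) :
                  Matrix (Fin 2) (Fin 2) ℂ) * μ c.tgt
                * star ((Averaging.iter (fun i => blockAvg (P := F.P K) (j := i) (expMeanLogSU (n := Fin 2))) (K - n) U₀ c : Matrix.specialUnitaryGroup (Fin 2) ℂ) :
                  Matrix (Fin 2) (Fin 2) ℂ))‖ := by
  -- the fine extension `λ := μ ∘ iterBlockOf (K−n)` of the coarse gauge function and its gauge direction `Z^λ`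
  set lam : Site (F.P K) 0 → Matrix (Fin 2) (Fin 2) ℂ := fun x => μ (iterBlockOf (K - n) x) with hlam
  have hlam_emb : ∀ y : Site (F.P K) (K - n), lam (embIter (K - n) y) = μ y := fun y => by
    rw [hlam]
    exact congrArg μ (iterBlockOf_embIter_eq (show K - n ≤ (F.P K).m + (F.P K).K from by show K - n ≤ F.m + K; omega) y)
  have hlam_su : ∀ x, lam x ∈ skewAdjoint (Matrix (Fin 2) (Fin 2) ℂ) := fun x => hμ _
  have hlam_tr : ∀ x, (lam x).trace = 0 := fun x => hμt _
  -- the gauged direction `A − Z^λ` is `𝔰𝔲(2)`-valued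
  have hAZ : ∀ b : PBond (F.P K) 0, (fun b : PBond (F.P K) 0 => A b - (lam b.src - (U₀ b : Matrix (Fin 2) (Fin 2) ℂ) * lam (b.src.shift b.dir) * star (U₀ b : Matrix (Fin 2) (Fin 2) ℂ))) b
      ∈ skewAdjoint (Matrix (Fin 2) (Fin 2) ℂ) := fun b =>
    (sub_gaugeDir_mem_su2 (hA b) (htr b) (gaugeDir_mem_su2 (hlam_su _) (hlam_tr _) (hlam_su _) (hlam_tr _) (U₀ b)).1
      (gaugeDir_mem_su2 (hlam_su _) (hlam_tr _) (hlam_su _) (hlam_tr _) (U₀ b)).2).1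
  have hAZt : ∀ b : PBond (F.P K) 0, ((fun b : PBond (F.P K) 0 => A b - (lam b.src - (U₀ b : Matrix (Fin 2) (Fin 2) ℂ) * lam (b.src.shift b.dir) * star (U₀ b : Matrix (Fin 2) (Fin 2) ℂ))) b).trace = 0 :=
    fun b => (sub_gaugeDir_mem_su2 (hA b) (htr b) (gaugeDir_mem_su2 (hlam_su _) (hlam_tr _) (hlam_su _) (hlam_tr _) (U₀ b)).1
      (gaugeDir_mem_su2 (hlam_su _) (hlam_tr _) (hlam_su _) (hlam_tr _) (U₀ b)).2).2
  -- gauge invariance of the first variation and the exact pairing along `A − Z^λ`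
  have hinv := lin_sub_gaugeDir_eq U₀ A lam
  have hEL := abs_lin_le_sum_norm_trueLinIter_weakEL F hnK hU₀fib hELw hε₀ hε hU₀reg Q hQ0 hQs
    (fun b : PBond (F.P K) 0 => A b - (lam b.src - (U₀ b : Matrix (Fin 2) (Fin 2) ℂ) * lam (b.src.shift b.dir) * star (U₀ b : Matrix (Fin 2) (Fin 2) ℂ))) hAZ hAZt
  beta_reduce at hinv hEL
  rw [hinv] at hEL
  refine hEL.trans (le_of_eq ?_)
  congr 1
  refine Finset.sum_congr rfl fun c _ => ?_
  -- `Q (K−n) (A − Z^λ) = Q (K−n) A − P_{Ū₀^{(K−n)}}(λ ∘ embIter (K−n))`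
  obtain ⟨hα, _, haN⟩ := tower_loop_rows_of_regPr F hε₀ hε hU₀reg (K := K) (n := n)
  have hg : ∀ j < K - n, ∀ (c : PBond (F.P K) (j + 1)) (i : Idx (F.P K)),
      dist1 (loopHol (Averaging.iter (fun i => blockAvg (P := F.P K) (j := i) (expMeanLogSU (n := Fin 2))) j U₀) c i) < deltaSU (Fin 2) :=
    fun j hj c i => (hα j hj c i).trans_lt (haN j hj)
  have hsub := trueLinIter_sub U₀ Q hQ0 hQs (K - n) A
    (fun b : PBond (F.P K) 0 => lam b.src - ((U₀ b : Matrix.specialUnitaryGroup (Fin 2) ℂ) : Matrix (Fin 2) (Fin 2) ℂ) * lam b.tgt *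
      star ((U₀ b : Matrix.specialUnitaryGroup (Fin 2) ℂ) : Matrix (Fin 2) (Fin 2) ℂ)) c
  have hpg := trueLinIter_pureGauge U₀ Q hQ0 hQs lam (K - n) hg c
  have hfun : (fun b : PBond (F.P K) 0 => A b - (lam b.src - (U₀ b : Matrix (Fin 2) (Fin 2) ℂ) * lam (b.src.shift b.dir) * star (U₀ b : Matrix (Fin 2) (Fin 2) ℂ)))
      = A - (fun b : PBond (F.P K) 0 => lam b.src - ((U₀ b : Matrix.specialUnitaryGroup (Fin 2) ℂ) : Matrix (Fin 2) (Fin 2) ℂ) * lam b.tgt *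
            star ((U₀ b : Matrix.specialUnitaryGroup (Fin 2) ℂ) : Matrix (Fin 2) (Fin 2) ℂ)) := by
    funext b; rfl
  rw [hfun, hsub, hpg, hlam_emb, hlam_emb]

/-! ## §2 `hcoW` of the EX knit from the gauged rows -/

set_option maxHeartbeats 400000 in
/-- ★★★ **`hcoW` OF THE EX KNIT OF RECORD FROM CHART ∧ HESS_W′ ∧ THE JOINT REMAINDER ROW MODULO COARSE GAUGE, AT THE E–L-CRITICAL CHART BACKGROUND.**  Hypothesis
`hQW` = ✓`Prop7HcoWOfQRows.hcoW_of_QRowsW`'s VERBATIM except the JOINT row, displayed modulo an `𝔰𝔲(2)`-valued coarse site field `μ` (after `Q`) exactly as in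
✓`Prop7LocMinOfGaugedRows.isMinOn_regFibrePr_of_gaugedRows_at`; conclusion = `hcoW` of ✓`Prop7StubEXOfChartPiecesTwS5.stubEX_of_chartPiecesTwS5` VERBATIM.  See the module
docstring. [cite: Balaban1985Variational, (141)-(143) p.299, (116) p.295, (47)-(49) pp.285-286, (112) p.294, (2), (6) p.278; Balaban1985BackgroundPropagators, (3.11) p.392] -/
theorem hcoW_of_gaugedRowsW
    (hQW : ∀ (L : ℕ), 1 < L → ∀ (B₁ : ℝ), 0 < B₁ → ∃ e₇ c₇ : ℝ, 0 < e₇ ∧ 0 < c₇ ∧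
      ∀ (F : T3Family), F.L = L → ∀ (n K : ℕ) (hnK : n < K) (e α : ℝ) (V : GaugeField (F.P n) 0 (Matrix.specialUnitaryGroup (Fin 2) ℂ))
        (W U₁ : GaugeField (F.P K) 0 (Matrix.specialUnitaryGroup (Fin 2) ℂ)) (u : GaugeTransf (F.P K) 0 (Matrix.specialUnitaryGroup (Fin 2) ℂ))
        (A : PBond (F.P K) 0 → Matrix (Fin 2) (Fin 2) ℂ),
        0 < e → e ≤ e₇ → 0 < α → α ≤ c₇ → W ∈ regFibrePr F n K hnK.le e V →
        (∀ γ : ℝ → GaugeField (F.P K) 0 (Matrix.specialUnitaryGroup (Fin 2) ℂ), γ 0 = W → (∀ t, γ t ∈ fibre F ℰp n K hnK.le V) →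
          (∀ b, DifferentiableAt ℝ (fun t => ((γ t b : Matrix.specialUnitaryGroup (Fin 2) ℂ) : Matrix (Fin 2) (Fin 2) ℂ)) 0) →
            deriv (fun t => wilsonAction4 (γ t)) 0 = 0) →
        RestrictedPrint F n K W u → (∀ b : PBond (F.P K) 0, IsSelfAdjoint (A b)) →
        (∀ b : PBond (F.P K) 0, ((U₁ b : Matrix.specialUnitaryGroup (Fin 2) ℂ) : Matrix (Fin 2) (Fin 2) ℂ) = exp (Complex.I • ((eta F n K) • A b))) →
        (∃ (β₀ B₂ : ℝ) (len : B7Prop1Explicit.Site (F.P K).d → ℝ),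
          B8Thm2TorusAt.C136T (F.P K).L (K - n) (eta F n K) β₀ B₁ B₂ len α (pull (bgUnits F K W) (basePt F n K)) (pull A (basePt F n K))) →
        B8Eq138LandauZd.IsLandau138 (F.P K).L (K - n) (eta F n K) (Set.univ : Set (B7Prop1Explicit.Site (F.P K).d)) (B8Thm4TorusAt.torusLam (K - n))
          (pull (bgUnits F K W) (basePt F n K)) (pull A (basePt F n K)) →
        B8Thm2TorusAt.C139T (F.P K).L (K - n) (eta F n K) B₁ α (pull (bgUnits F K W) (basePt F n K)) (pull A (basePt F n K)) →
        GaugeField.gaugeAct u (emb15 W U₁) ∈ regFibrePr F n K hnK.le e V →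
          ∃ s κ C₁ C₂ : ℝ, (∀ b : PBond (F.P K) 0, ‖(eta F n K • A) b‖ ≤ s) ∧ 4 * s ≤ 1 ∧
            κ * ∑ b : PBond (F.P K) 0, ‖(eta F n K • A) b‖ ^ 2 ≤ ∑ p : Plaq (F.P K) 0, ‖((Complex.I • (eta F n K • A) ⟨p.src, p.μ⟩) + ((W ⟨p.src, p.μ⟩ : Matrix (Fin 2) (Fin 2) ℂ) * (Complex.I • (eta F n K • A) ⟨p.src.shift p.μ, p.ν⟩) * star (W ⟨p.src, p.μ⟩ : Matrix (Fin 2) (Fin 2) ℂ))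
            - (((W ⟨p.src, p.μ⟩ * W ⟨p.src.shift p.μ, p.ν⟩ * (W ⟨p.src.shift p.ν, p.μ⟩)⁻¹ : Matrix.specialUnitaryGroup (Fin 2) ℂ) : Matrix (Fin 2) (Fin 2) ℂ) * (Complex.I • (eta F n K • A) ⟨p.src.shift p.ν, p.μ⟩) * star ((W ⟨p.src, p.μ⟩ * W ⟨p.src.shift p.μ, p.ν⟩ * (W ⟨p.src.shift p.ν, p.μ⟩)⁻¹ : Matrix.specialUnitaryGroup (Fin 2) ℂ) : Matrix (Fin 2) (Fin 2) ℂ))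
            - (((GaugeField.plaqHol W p : Matrix.specialUnitaryGroup (Fin 2) ℂ) : Matrix (Fin 2) (Fin 2) ℂ) * (Complex.I • (eta F n K • A) ⟨p.src, p.ν⟩) * star ((GaugeField.plaqHol W p : Matrix.specialUnitaryGroup (Fin 2) ℂ) : Matrix (Fin 2) (Fin 2) ℂ)))‖ ^ 2 ∧
            (∀ (Q : (k : ℕ) → (PBond (F.P K) 0 → Matrix (Fin 2) (Fin 2) ℂ) → PBond (F.P K) k → Matrix (Fin 2) (Fin 2) ℂ), (∀ Y, Q 0 Y = Y) →
        (∀ (k : ℕ) (Y : PBond (F.P K) 0 → Matrix (Fin 2) (Fin 2) ℂ) (c : PBond (F.P K) (k + 1)), Q (k + 1) Y c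
          = fderiv ℂ (eml : (Idx (F.P K) → Matrix (Fin 2) (Fin 2) ℂ) → Matrix (Fin 2) (Fin 2) ℂ)
              (fun i => ((loopHol (Averaging.iter (fun i => blockAvg (P := F.P K) (j := i) (expMeanLogSU (n := Fin 2))) k W) c i :
                Matrix.specialUnitaryGroup (Fin 2) ℂ) : Matrix (Fin 2) (Fin 2) ℂ))
              (fun i => covWalkSum (Averaging.iter (fun i => blockAvg (P := F.P K) (j := i) (expMeanLogSU (n := Fin 2))) k W) (Q k Y)
                  (walk (emb c.src) (loopWord (F.P K).L c.dir (off i.1) i.2.1 i.2.2))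
                * ((loopHol (Averaging.iter (fun i => blockAvg (P := F.P K) (j := i) (expMeanLogSU (n := Fin 2))) k W) c i :
                  Matrix.specialUnitaryGroup (Fin 2) ℂ) : Matrix (Fin 2) (Fin 2) ℂ))
              * star ((corr (expMeanLogSU (n := Fin 2)) (Averaging.iter (fun i => blockAvg (P := F.P K) (j := i) (expMeanLogSU (n := Fin 2))) k W) c :
                  Matrix.specialUnitaryGroup (Fin 2) ℂ) : Matrix (Fin 2) (Fin 2) ℂ)
            + ((corr (expMeanLogSU (n := Fin 2)) (Averaging.iter (fun i => blockAvg (P := F.P K) (j := i) (expMeanLogSU (n := Fin 2))) k W) c :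
                  Matrix.specialUnitaryGroup (Fin 2) ℂ) : Matrix (Fin 2) (Fin 2) ℂ)
              * covWalkSum (Averaging.iter (fun i => blockAvg (P := F.P K) (j := i) (expMeanLogSU (n := Fin 2))) k W) (Q k Y)
                  (walk (emb c.src) (List.replicate (F.P K).L (c.dir, true)))
              * star ((corr (expMeanLogSU (n := Fin 2)) (Averaging.iter (fun i => blockAvg (P := F.P K) (j := i) (expMeanLogSU (n := Fin 2))) k W) c :
                  Matrix.specialUnitaryGroup (Fin 2) ℂ) : Matrix (Fin 2) (Fin 2) ℂ)) →
            ∃ μ : Site (F.P K) (K - n) → Matrix (Fin 2) (Fin 2) ℂ, (∀ y, μ y ∈ skewAdjoint (Matrix (Fin 2) (Fin 2) ℂ) ∧ (μ y).trace = 0) ∧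
            ∑ c : PBond (F.P K) (K - n), ‖Q (K - n) (fun b => Complex.I • (eta F n K • A) b) c
                - (μ c.src
                  - ((Averaging.iter (fun i => blockAvg (P := F.P K) (j := i) (expMeanLogSU (n := Fin 2))) (K - n) W c : Matrix.specialUnitaryGroup (Fin 2) ℂ) :
                      Matrix (Fin 2) (Fin 2) ℂ) * μ c.tgt
                    * star ((Averaging.iter (fun i => blockAvg (P := F.P K) (j := i) (expMeanLogSU (n := Fin 2))) (K - n) W c : Matrix.specialUnitaryGroup (Fin 2) ℂ) :
                      Matrix (Fin 2) (Fin 2) ℂ))‖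
              ≤ C₁ * ((F.L : ℝ) ^ (K - n))⁻¹ * ∑ b : PBond (F.P K) 0, ‖(eta F n K • A) b‖ ^ 2
                + C₂ * (F.L : ℝ) ^ (K - n) * ∑ p : Plaq (F.P K) 0, ‖((Complex.I • (eta F n K • A) ⟨p.src, p.μ⟩) + ((W ⟨p.src, p.μ⟩ : Matrix (Fin 2) (Fin 2) ℂ) * (Complex.I • (eta F n K • A) ⟨p.src.shift p.μ, p.ν⟩) * star (W ⟨p.src, p.μ⟩ : Matrix (Fin 2) (Fin 2) ℂ))
            - (((W ⟨p.src, p.μ⟩ * W ⟨p.src.shift p.μ, p.ν⟩ * (W ⟨p.src.shift p.ν, p.μ⟩)⁻¹ : Matrix.specialUnitaryGroup (Fin 2) ℂ) : Matrix (Fin 2) (Fin 2) ℂ) * (Complex.I • (eta F n K • A) ⟨p.src.shift p.ν, p.μ⟩) * star ((W ⟨p.src, p.μ⟩ * W ⟨p.src.shift p.μ, p.ν⟩ * (W ⟨p.src.shift p.ν, p.μ⟩)⁻¹ : Matrix.specialUnitaryGroup (Fin 2) ℂ) : Matrix (Fin 2) (Fin 2) ℂ))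
            - (((GaugeField.plaqHol W p : Matrix.specialUnitaryGroup (Fin 2) ℂ) : Matrix (Fin 2) (Fin 2) ℂ) * (Complex.I • (eta F n K • A) ⟨p.src, p.ν⟩) * star ((GaugeField.plaqHol W p : Matrix.specialUnitaryGroup (Fin 2) ℂ) : Matrix (Fin 2) (Fin 2) ℂ)))‖ ^ 2) ∧
            2 * e * C₂ ≤ 1 / 8 ∧
            2 * e * C₁ * (((F.L : ℝ) ^ (K - n)) ^ 2)⁻¹ + 15552 * s ^ 2 + 216 * regThreshold F n K e ≤ κ / 8) :
    ∀ (L : ℕ), 1 < L → ∀ (B₁ : ℝ), 0 < B₁ → ∃ e₇ c₇ : ℝ, 0 < e₇ ∧ 0 < c₇ ∧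
      ∀ (F : T3Family), F.L = L → ∀ (n K : ℕ) (hnK : n < K) (e α : ℝ) (V : GaugeField (F.P n) 0 (Matrix.specialUnitaryGroup (Fin 2) ℂ))
        (W U₁ : GaugeField (F.P K) 0 (Matrix.specialUnitaryGroup (Fin 2) ℂ)) (u : GaugeTransf (F.P K) 0 (Matrix.specialUnitaryGroup (Fin 2) ℂ))
        (A : PBond (F.P K) 0 → Matrix (Fin 2) (Fin 2) ℂ),
        0 < e → e ≤ e₇ → 0 < α → α ≤ c₇ → W ∈ regFibrePr F n K hnK.le e V →
        (∀ γ : ℝ → GaugeField (F.P K) 0 (Matrix.specialUnitaryGroup (Fin 2) ℂ), γ 0 = W → (∀ t, γ t ∈ fibre F ℰp n K hnK.le V) →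
          (∀ b, DifferentiableAt ℝ (fun t => ((γ t b : Matrix.specialUnitaryGroup (Fin 2) ℂ) : Matrix (Fin 2) (Fin 2) ℂ)) 0) →
            deriv (fun t => wilsonAction4 (γ t)) 0 = 0) →
        RestrictedPrint F n K W u → (∀ b : PBond (F.P K) 0, IsSelfAdjoint (A b)) →
        (∀ b : PBond (F.P K) 0, ((U₁ b : Matrix.specialUnitaryGroup (Fin 2) ℂ) : Matrix (Fin 2) (Fin 2) ℂ) = exp (Complex.I • ((eta F n K) • A b))) →
        (∃ (β₀ B₂ : ℝ) (len : B7Prop1Explicit.Site (F.P K).d → ℝ),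
          B8Thm2TorusAt.C136T (F.P K).L (K - n) (eta F n K) β₀ B₁ B₂ len α (pull (bgUnits F K W) (basePt F n K)) (pull A (basePt F n K))) →
        B8Eq138LandauZd.IsLandau138 (F.P K).L (K - n) (eta F n K) (Set.univ : Set (B7Prop1Explicit.Site (F.P K).d)) (B8Thm4TorusAt.torusLam (K - n))
          (pull (bgUnits F K W) (basePt F n K)) (pull A (basePt F n K)) →
        B8Thm2TorusAt.C139T (F.P K).L (K - n) (eta F n K) B₁ α (pull (bgUnits F K W) (basePt F n K)) (pull A (basePt F n K)) →
        GaugeField.gaugeAct u (emb15 W U₁) ∈ regFibrePr F n K hnK.le e V →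
          wilsonAction4 W ≤ wilsonAction4 (emb15 W U₁) := by
  intro L hL B₁ hB₁
  obtain ⟨e₇, c₇, he₇, hc₇, H⟩ := hQW L hL B₁ hB₁
  have hL0 : (0 : ℝ) < (L : ℝ) := by exact_mod_cast (show 0 < L by omega)
  have hbig : (0 : ℝ) < 10 ^ 10 * (L : ℝ) ^ 6 := by positivity
  refine ⟨min e₇ (10 ^ 10 * (L : ℝ) ^ 6)⁻¹, c₇, lt_min he₇ (inv_pos.mpr hbig), hc₇, ?_⟩
  intro F hF n K hnK e α V W U₁ u A he heε hα hαc hWreg hEL hRP hA hU₁ h136 h138 h139 hmem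
  have he₇ : e ≤ e₇ := heε.trans (min_le_left _ _)
  have heL : 10 ^ 10 * (F.L : ℝ) ^ 6 * e ≤ 1 := by
    rw [hF]
    have h1 : e ≤ (10 ^ 10 * (L : ℝ) ^ 6)⁻¹ := heε.trans (min_le_right _ _)
    calc 10 ^ 10 * (L : ℝ) ^ 6 * e ≤ 10 ^ 10 * (L : ℝ) ^ 6 * (10 ^ 10 * (L : ℝ) ^ 6)⁻¹ := mul_le_mul_of_nonneg_left h1 hbig.le
      _ = 1 := mul_inv_cancel₀ hbig.ne'
  obtain ⟨s, κ, C₁, C₂, hDs, hs4, hq, hJ, hw₁, hw₂⟩ :=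
    H F hF n K hnK e α V W U₁ u A he he₇ hα hαc hWreg hEL hRP hA hU₁ h136 h138 h139 hmem
  -- the direction `D := η·A` is Hermitian-traceless, so `U₁ = expHermField (η·A)` and `I•D` is `𝔰𝔲(2)`-valued
  have hDh : ∀ b : PBond (F.P K) 0, ((eta F n K • A) b).IsHermitian ∧ Matrix.trace ((eta F n K • A) b) = 0 := fun b => by
    have hmemb : exp (Complex.I • ((eta F n K) • A b)) ∈ Matrix.specialUnitaryGroup (Fin 2) ℂ := hU₁ b ▸ (U₁ b).prop
    exact ⟨(IsSelfAdjoint.all (eta F n K)).smul (hA b), trace_eq_zero_of_exp_mem_SU2 hmemb ((hDs b).trans (by linarith))⟩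
  have hU₁eq : U₁ = expHermField (eta F n K • A) := by
    funext b
    apply Subtype.ext
    rw [hU₁ b, expHermField_apply, coe_expHerm (hDh b)]
    rfl
  obtain ⟨hWfib, hreg⟩ := (mem_regFibrePr_iff F).mp hWreg
  -- a recursion family of the true linearisations along `W`'s tower, and (141) in the `Q`-currency at the E–L-critical `W`
  obtain ⟨Q, hQ0, hQs⟩ := exists_trueLinIter_family (N := 2) W
  obtain ⟨μ, hμ, hJμ⟩ := hJ Q hQ0 hQs
  -- (141) MODULO COARSE GAUGE at the E–L-critical `W` (§1): the multiplier current is covariantly conserved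
  have hELQ := abs_lin_le_sum_norm_trueLinIter_weakEL_sub_coarseGauge F hnK.le hWfib (weakEL_of_fibreEL F hnK.le hEL) he heL hreg Q hQ0 hQs
    (fun b => Complex.I • (eta F n K • A) b)
    (fun b => by
      rw [skewAdjoint.mem_iff, star_smul, Complex.star_def, Complex.conj_I, Matrix.star_eq_conjTranspose, (hDh b).1.eq, neg_smul])
    (fun b => by rw [Matrix.trace_smul, (hDh b).2, smul_zero])
    μ (fun y => (hμ y).1) (fun y => (hμ y).2)
  beta_reduce at hELQ
  have hlin := linRow_of_QRows F he.le W (eta F n K • A) hELQ hJμ hq hw₁ hw₂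
  rw [hU₁eq]
  exact wilsonAction4_le_expChart_of_linRow F hreg (eta F n K • A) hDh hDs hs4 hlin

end Summit.QuantumFields.YangMills.Theorems.Prop7HcoWOfGaugedRows

end
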